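import Summits.HodgeConjecture.HodgeConjecture.Theorems.NikulinTwinTransportSquareGlueFree

/-!
# Route MarkmanPartnerTransport · crux `PicardThreeK3Squares` (stmt-HodgeConjecture-19652) —
# the Hodge conjecture for `S × S` on the CYCLE-INDUCED sector (`End_Hdg(T(S))` algebraic)

The crux `PicardThreeK3Squares` (HC⁴ of `S × S` for projective K3 surfaces with `ρ(S) ≥ 3`) has the
real-multiplication third as its open core; every known case (CM: Buskin / Ramón-Marí; `E = ℚ`;
the van Geemen–Schütt RM families) goes through Varesco's bookkeeping "HC for `S²` ⟺ every element of
`End_Hdg(T(S))` is algebraic" (Varesco 2023, §2 p. 8). The tree had it for the sector `ℚ + ℚe`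
(`SquareGlueFree.hodgeConjectureFor_square_of_sector`, marking-free and `b₁`-free). This file proves
the GENERAL sector version, for EVERY smooth projective complex surface `S` and every orientation
family `μ`:

* `exists_algebraicClass_of_corrFst_of_cycleInduced` — the endomorphism theorem of
  `SquareGlueFreeEndomorphisms` on the general sector: if every rational Hodge endomorphism `f` of `H²`
  killing `N = N¹H²` with image `⊥ N` agrees on `T = N^⊥` with some `N`-stable endomorphism `g` induced
  by an algebraic class on `S × S`, then every rational `(2,2)`-class `z` of `S × S` acts on `H²(S)` as
  an ALGEBRAIC class does (same proof: `u[z]_* = g` on `T`; `u[z]_* - g` kills `T` and maps the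
  Néron–Severi basis into `N`, hence is the action of `κ⁻¹ Σᵢ pr₁^* cᵢ ∪ pr₂^* dᵢ^∨`).
* `mem_algebraicClasses_two_of_cycleInducedSector` — rational `(2,2)`-classes of `S × S` are then
  algebraic (the difference is divisor-supported, `mem_supportedClasses_one_of_corrFst_eq_zero`, and
  divisor-supported rational `(2,2)`-classes of a fourfold are algebraic,
  `PgOneProductClasses.mem_algebraicClasses_two_of_mem_supportedClasses_one`).
* `hodgeConjectureFor_square_of_cycleInducedSector` — `HodgeConjectureFor 4 (S ⊗ S)` on that sector
  (other codimensions by Lefschetz `(1,1)` and hard Lefschetz).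

Consumer: `Theorems/MarkmanPartnerTransportPicardThreeK3SquaresSquareOfGenerator` (rung F4
`SquareOfGenerator` of line `cm-anchor-spread`: the sector `ℚ[t]` of a cycle-induced generator).
No definition, no named-fact hypothesis, no sorry. Prover seat hodge-nonav-19652-p1 (gen 0),
`--supports stmt-HodgeConjecture-19652`.

References: Varesco, *Hodge similitudes and the Hodge conjecture for squares of K3 surfaces* (2023), §2
p. 8; Voisin, *Hodge Theory and Complex Algebraic Geometry I*, Lemma 11.41, Thm. 11.30; Deligne,
Hodge III, Cor. 8.2.8.
-/

set_option linter.dupNamespace false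

noncomputable section

namespace Summit.HodgeConjecture.HodgeConjecture.Theorems.MarkmanPartnerTransport.CycleInducedSector

open scoped Manifold
open CategoryTheory MonoidalCategory CartesianMonoidalCategory
open Literature.AlgebraicGeometry Literature.AlgebraicGeometry.Motives Literature.AlgebraicGeometry.HodgeTheory
open Literature.AlgebraicTopology.SingularHomology
open Summit.HodgeConjecture.HodgeConjecture.Theorems.NikulinTwinTransport
open Summit.HodgeConjecture.HodgeConjecture.Theorems.NikulinTwinTransport.SquareGlueFree

variable {S : SchemeOver ℂ}

/-- `Corr[μ, hS ; γ, y] = pr₁_*(pr₂^* y ∪ γ)` on `H²(S(ℂ); ℂ)` — the action of a class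
`γ ∈ H⁴((S ⊗ S)(ℂ))` (as in `SquareGlueFree` and in `IsCycleInducedTranscendentalEndomorphism`). Local
notation only. -/
local notation3 (prettyPrint := false) "Corr[" μ ", " hS " ; " γ ", " y "]" =>
  complexGysin μ (IsSmoothProjective.tensor_holds hS hS) hS
    (SemiCartesianMonoidalCategory.fst _ _) (rfl : 2 * 1 + 2 * 2 + 2 * 2 = 2 * 1 + 2 * (2 + 2))
    (cupProduct (rfl : 2 * 1 + 2 * 2 = 2 * 1 + 2 * 2)
      (complexBetti.map (SemiCartesianMonoidalCategory.snd _ _) (2 * 1) y) γ)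

/-! ### The endomorphism theorem on the general sector -/

/-- **Every rational `(2,2)`-class of `S × S` acts on `H²(S)` as an ALGEBRAIC class does, on the
cycle-induced sector.** Let `S` be a smooth projective complex surface and `μ` an orientation family.
Suppose every `ℂ`-linear endomorphism `f` of `H²(S(ℂ); ℂ)` preserving rational classes and Hodge types,
killing `N = algebraicClasses S 1` and with image cup-orthogonal to `N`, agrees on `T = N^⊥` with an
endomorphism `g` mapping `N` into `N` and induced by an algebraic class (`g = [γ]_*`,
`γ ∈ algebraicClasses (S ⊗ S) 2`). Then every rational class `z ∈ H⁴((S ⊗ S)(ℂ))` of type `(2,2)` has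
an algebraic `Γ` with `pr₁_*(pr₂^* y ∪ Γ) = pr₁_*(pr₂^* y ∪ z)` for all `y`. Proof as in
`SquareGlueFree.exists_algebraicClass_of_corrFst`: `F = u[z]_*` is rational and type-preserving and maps
`T` to `T`; `π_T F π_T` satisfies the hypotheses, so `F = g` on `T`; `F - g` kills `T` and maps the
rational divisor basis `dᵢ` to `cᵢ ∈ N` (`F dᵢ` is a rational `(1,1)`-class, `g dᵢ ∈ N`), so it is the
action of the algebraic `κ⁻¹ Σᵢ pr₁^* cᵢ ∪ pr₂^* dᵢ^∨`. [cite: Varesco2023, §2 (p. 8)]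
[cite: VoisinHodgeI2002, §11.3.3 Lemma 11.41 and Thm. 11.30] -/
theorem exists_algebraicClass_of_corrFst_of_cycleInduced (μ : OrientationFamily)
    (hS : IsSmoothProjective 2 S)
    (hU : ∀ (f : complexBetti S (2 * 1) →ₗ[ℂ] complexBetti S (2 * 1)),
      (∀ y, IsRationalClass y → IsRationalClass (f y)) →
      (∀ (i j : ℕ) y, IsOfHodgeType 2 S (2 * 1) i j y → IsOfHodgeType 2 S (2 * 1) i j (f y)) →
      (∀ d ∈ algebraicClasses S 1, f d = 0) →
      (∀ y : complexBetti S (2 * 1), ∀ d ∈ algebraicClasses S 1,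
        cupProduct (rfl : 2 * 1 + 2 * 1 = 2 * 2) (f y) d = 0) →
      ∃ g : complexBetti S (2 * 1) →ₗ[ℂ] complexBetti S (2 * 1),
        (∀ d ∈ algebraicClasses S 1, g d ∈ algebraicClasses S 1) ∧
        (∃ γ ∈ algebraicClasses (S ⊗ S) 2, ∀ y : complexBetti S (2 * 1), g y = Corr[μ, hS ; γ, y]) ∧
        ∀ y : complexBetti S (2 * 1),
          (∀ d ∈ algebraicClasses S 1, cupProduct (rfl : 2 * 1 + 2 * 1 = 2 * 2) y d = 0) → f y = g y)
    {z : complexBetti (S ⊗ S) (2 * 2)} (hzQ : IsRationalClass z)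
    (hzT : IsOfHodgeType (2 + 2) (S ⊗ S) (2 * 2) 2 2 z) :
    ∃ Γ ∈ algebraicClasses (S ⊗ S) 2, ∀ y : complexBetti S (2 * 1),
      Corr[μ, hS ; Γ, y] = Corr[μ, hS ; z, y] := by
  classical
  have h4 : 2 * 1 + 2 * 1 = 2 * 2 := rfl
  have hI := hodgePQ_independent_of_hodgeModel_holds
  have hdR : ∀ (E : Type) [NormedAddCommGroup E] [NormedSpace ℂ E] [FiniteDimensional ℂ E],
      Literature.NumberTheory.Transcendental.exists_deRhamIsoFamily 𝓘(ℝ, E) :=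
    fun E _ _ _ ↦ Literature.NumberTheory.Transcendental.exists_deRhamIsoFamily_holds E
  have hSS := IsSmoothProjective.tensor_holds hS hS
  obtain ⟨B, -⟩ := id hzT
  obtain ⟨A⟩ := nonempty_hodgeModel_holds (n := 2) (X := S) hS
  set N : Submodule ℂ (complexBetti S (2 * 1)) := algebraicClasses S 1 with hNdef
  have hN11 : ∀ d ∈ N, IsOfHodgeType 2 S (2 * 1) 1 1 d :=
    fun d hd ↦ isOfHodgeType_of_mem_algebraicClasses_of_isSmoothProjective hS 1 hd
  have hL11 : ∀ c : complexBetti S (2 * 1), IsRationalClass c → IsOfHodgeType 2 S (2 * 1) 1 1 c →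
      c ∈ N :=
    fun c hc h11 ↦ lefschetzOneOne_rational_holds hS c hc h11
  -- the action of `z` on `H²(S)` as a linear map, rational up to `u`, type-preserving
  let Fc : complexBetti S (2 * 1) →ₗ[ℂ] complexBetti S (2 * 1) :=
    (complexGysin μ hSS hS (fst S S) (rfl : 2 * 1 + 2 * 2 + 2 * 2 = 2 * 1 + 2 * (2 + 2))) ∘ₗ
      ((cupProduct (rfl : 2 * 1 + 2 * 2 = 2 * 1 + 2 * 2)).flip z) ∘ₗ
        (complexBetti.map (snd S S) (2 * 1)).hom
  obtain ⟨u, hu0, hu⟩ := exists_smul_complexGysin_isRationalClass μ hSS hS (fst S S)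
    (rfl : 2 * 1 + 2 * 2 + 2 * 2 = 2 * 1 + 2 * (2 + 2))
  set F : complexBetti S (2 * 1) →ₗ[ℂ] complexBetti S (2 * 1) := u • Fc with hFdef
  have hF : ∀ y, F y = u • Corr[μ, hS ; z, y] := fun y ↦ rfl
  have hF_rat : ∀ y, IsRationalClass y → IsRationalClass (F y) := fun y hy ↦ by
    rw [hF]
    exact hu _ (IsRationalClass.cup _ (IsRationalClass.map _ hy) hzQ)
  have hF_typ : ∀ (i j : ℕ) y, IsOfHodgeType 2 S (2 * 1) i j y →
      IsOfHodgeType 2 S (2 * 1) i j (F y) :=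
    fun i j y hy ↦ by
      rw [hF]
      exact (isOfHodgeType_corrFst hI hdR μ hS hS B A (rfl : 2 * 1 + 2 * 2 = 2 * 1 + 2 * 2)
        (rfl : 2 * 1 + 2 * 2 + 2 * 2 = 2 * 1 + 2 * (2 + 2)) hzT (rfl : i + 2 = i + 2)
        (rfl : j + 2 = j + 2) hy).smul u
  -- `F` maps `T` into `T` (`Hom_Hdg(T, N) = 0`)
  have hF_T : ∀ y, (∀ d ∈ N, cupProduct h4 y d = 0) → ∀ d ∈ N, cupProduct h4 (F y) d = 0 := by
    intro y hy d hd
    rw [hF, map_smul, LinearMap.smul_apply, cupProduct_corrFst_eq_zero_of_orthogonal μ hS hzQ hzT hy hd,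
      smul_zero]
  -- the Néron–Severi projection and `f = π_T F π_T`
  obtain ⟨π, hπN, hπid, hπT, hπorth, hπQ, hπtyp⟩ := exists_nsProjection_free hS
  set f : complexBetti S (2 * 1) →ₗ[ℂ] complexBetti S (2 * 1) :=
    (LinearMap.id - π) ∘ₗ F ∘ₗ (LinearMap.id - π) with hfdef
  have hf : ∀ y, f y = F (y - π y) - π (F (y - π y)) := fun y ↦ by
    simp only [hfdef, LinearMap.comp_apply, LinearMap.sub_apply, LinearMap.id_apply]
  have hf_rat : ∀ y, IsRationalClass y → IsRationalClass (f y) := fun y hy ↦ by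
    rw [hf]
    have h1 : IsRationalClass (F (y - π y)) := hF_rat _ (isRationalClass_sub hy (hπQ y hy))
    exact isRationalClass_sub h1 (hπQ _ h1)
  have hf_typ : ∀ (i j : ℕ) y, IsOfHodgeType 2 S (2 * 1) i j y →
      IsOfHodgeType 2 S (2 * 1) i j (f y) :=
    fun i j y hy ↦ by
      rw [hf]
      exact (hπtyp i j _ (hF_typ i j _ (hπtyp i j y hy).2)).2
  have hf_N : ∀ d ∈ N, f d = 0 := fun d hd ↦ by
    rw [hf, hπid d hd, sub_self, map_zero, map_zero, sub_self]
  have hf_perp : ∀ y, ∀ d ∈ N, cupProduct h4 (f y) d = 0 := fun y d hd ↦ by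
    rw [hf]
    exact hπorth _ d hd
  obtain ⟨g, hgN, ⟨γ, hγalg, hγ⟩, hfg⟩ := hU f hf_rat hf_typ hf_N hf_perp
  -- on `T`: `F = g`
  have hFT : ∀ y, (∀ d ∈ N, cupProduct h4 y d = 0) → F y = g y := by
    intro y hy
    have hπy : π y = 0 := hπT y hy
    have hπFy : π (F y) = 0 := hπT _ (hF_T y hy)
    have h := hfg y hy
    rw [hf, hπy, sub_zero, hπFy, sub_zero] at h
    exact h
  -- `F₁ = F - g` kills `T`
  set F₁ : complexBetti S (2 * 1) →ₗ[ℂ] complexBetti S (2 * 1) := F - g with hF₁def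
  have hF₁ : ∀ y, F₁ y = F y - g y := fun y ↦ by
    simp only [hF₁def, LinearMap.sub_apply]
  have hF₁T : ∀ y, (∀ d ∈ N, cupProduct h4 y d = 0) → F₁ y = 0 := fun y hy ↦ by
    rw [hF₁, hFT y hy, sub_self]
  -- a rational basis of `N` with its Gram inverse, the classes `cᵢ = F₁ dᵢ ∈ N` and the dual basis
  obtain ⟨r, d, M, hdQ, hdN, hdli, hspanN, hmulinv, hinvmul⟩ := exists_neronSeveri_gramBasis hS
  have hmemS : ∀ x ∈ N, x ∈ Submodule.span ℂ (Set.range d) := fun x hx ↦ by rw [hspanN]; exact hx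
  set c : Fin r → complexBetti S (2 * 1) := fun i ↦ F₁ (d i) with hcdef
  have hcN : ∀ i, c i ∈ N := fun i ↦ by
    simp only [hcdef, hF₁]
    exact Submodule.sub_mem _ (hL11 _ (hF_rat _ (hdQ i)) (hF_typ 1 1 _ (hN11 _ (hdN i))))
      (hgN _ (hdN i))
  set dv : Fin r → complexBetti S (2 * 1) := fun i ↦ ∑ j, ((M i j : ℚ) : ℂ) • d j with hdvdef
  have hdvN : ∀ i, dv i ∈ N := fun i ↦ Submodule.sum_mem _ fun j _ ↦ Submodule.smul_mem _ _ (hdN j)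
  -- the linear map `G₁ y = Σᵢ (∫ y ∪ dᵢ^∨) cᵢ` equals `F₁`
  have hsymm : ∀ x y : complexBetti S (2 * 1), cupProduct h4 x y = cupProduct h4 y x := fun x y ↦ by
    rw [cupProduct_gradedComm_holds ℂ _ h4 h4]
    norm_num
  have htdv : ∀ i k, traceC hS (cupProduct h4 (d k) (dv i)) = if i = k then 1 else 0 := by
    intro i k
    simp only [hdvdef, map_sum, map_smul, smul_eq_mul]
    rw [← hinvmul i k]
    refine Finset.sum_congr rfl fun j _ ↦ ?_
    rw [hsymm (d k) (d j)]
  let G₁ : complexBetti S (2 * 1) →ₗ[ℂ] complexBetti S (2 * 1) :=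
    ∑ i, ((traceC hS) ∘ₗ ((cupProduct h4).flip (dv i))).smulRight (c i)
  have hG₁ : ∀ y, G₁ y = ∑ i, traceC hS (cupProduct h4 y (dv i)) • c i := fun y ↦ by
    simp only [G₁, LinearMap.sum_apply, LinearMap.smulRight_apply, LinearMap.comp_apply,
      LinearMap.flip_apply]
  have hG₁d : ∀ k, G₁ (d k) = F₁ (d k) := fun k ↦ by
    rw [hG₁]
    simp_rw [htdv]
    simp [ite_smul, Finset.sum_ite_eq', hcdef]
  have hG₁N : ∀ x ∈ N, G₁ x = F₁ x := by
    intro x hx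
    refine Submodule.span_induction (p := fun x _ ↦ G₁ x = F₁ x) ?_ ?_ ?_ ?_ (hmemS x hx)
    · rintro _ ⟨k, rfl⟩
      exact hG₁d k
    · rw [map_zero, map_zero]
    · intro x y _ _ hx hy
      rw [map_add, map_add, hx, hy]
    · intro t x _ hx
      rw [map_smul, map_smul, hx]
  have hG₁T : ∀ y, (∀ d ∈ N, cupProduct h4 y d = 0) → G₁ y = 0 := fun y hy ↦ by
    rw [hG₁]
    exact Finset.sum_eq_zero fun i _ ↦ by rw [hy _ (hdvN i), map_zero, zero_smul]
  have hG₁F₁ : ∀ y, G₁ y = F₁ y := fun y ↦ by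
    have hy : y = π y + (y - π y) := by abel
    rw [hy, map_add, map_add, hG₁N _ (hπN y), hG₁T _ (hπorth y), hF₁T _ (hπorth y)]
  -- fibre integration: `pr₁_*(pr₂^* ω) = κ • 1`, `κ ≠ 0`, for `ω` of trace one
  obtain ⟨ω, hω⟩ := exists_traceC_eq_one hS
  have hω0 : ω ≠ 0 := by
    rintro rfl
    rw [map_zero] at hω
    exact zero_ne_one hω
  obtain ⟨κ, hκ0, hκ⟩ := exists_fibreIntegral_fst μ hS hS (kunnethSpan_complexBetti hS hS (2 * (2 + 2)))
    hω0 (rfl : 2 * 2 + 2 * 2 = 0 + 2 * (2 + 2))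
  -- the algebraic class `Γ₁ = Σᵢ pr₁^* cᵢ ∪ pr₂^* dᵢ^∨` acts as `κ G₁`
  set Γ₁ : complexBetti (S ⊗ S) (2 * 2) :=
    ∑ i, cupProduct h4 (complexBetti.map (fst S S) (2 * 1) (c i))
      (complexBetti.map (snd S S) (2 * 1) (dv i)) with hΓ₁def
  have hΓ₁alg : Γ₁ ∈ algebraicClasses (S ⊗ S) 2 :=
    Submodule.sum_mem _ fun i _ ↦
      cupProduct_fst_snd_mem_algebraicClasses_of_eq hS hS (hcN i) (hdvN i) (rfl : 1 + 1 = 2) h4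
  have hΓ₁act : ∀ y, Corr[μ, hS ; Γ₁, y] = κ • G₁ y := by
    intro y
    rw [hG₁, Finset.smul_sum, hΓ₁def, map_sum, map_sum]
    refine Finset.sum_congr rfl fun i _ ↦ ?_
    rw [corrFst_cross_of_cup_eq μ hS hS h4 (rfl : 2 * 1 + 2 * 2 = 2 * 1 + 2 * 2) h4
      (rfl : 2 * 1 + 2 * 2 + 2 * 2 = 2 * 1 + 2 * (2 + 2)) (rfl : 2 * 2 + 2 * 2 = 0 + 2 * (2 + 2)) hκ
      (c i) (eq_traceC_smul hS hω (cupProduct h4 y (dv i))), smul_smul]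
    congr 1
    rw [show ((-1 : ℂ) ^ (2 * 1 * (2 * 1))) = 1 by norm_num, one_mul, mul_comm]
  -- the class `Γ`
  refine ⟨u⁻¹ • (κ⁻¹ • Γ₁ + γ),
    Submodule.smul_mem _ _ (Submodule.add_mem _ (Submodule.smul_mem _ _ hΓ₁alg) hγalg), fun y ↦ ?_⟩
  have hlin : Corr[μ, hS ; u⁻¹ • (κ⁻¹ • Γ₁ + γ), y] =
      u⁻¹ • (κ⁻¹ • Corr[μ, hS ; Γ₁, y] + Corr[μ, hS ; γ, y]) := by
    simp only [map_add, map_smul]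
  rw [hlin, hΓ₁act, ← hγ y, smul_smul, inv_mul_cancel₀ hκ0, one_smul, hG₁F₁, hF₁, sub_add_cancel, hF y,
    smul_smul, inv_mul_cancel₀ hu0, one_smul]

/-! ### Rational `(2,2)`-classes on `S × S` are algebraic on the cycle-induced sector -/

/-- **On the cycle-induced sector every rational `(2,2)`-class on `S × S` is algebraic**, for EVERY
smooth projective surface `S` and orientation family `μ`: with the algebraic `Γ` of
`exists_algebraicClass_of_corrFst_of_cycleInduced`, `z - Γ` acts trivially on `H²(S)`, hence is
supported on a divisor (`mem_supportedClasses_one_of_corrFst_eq_zero`); so is `Γ ∈ N² ⊆ N¹`; and a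
rational `(2,2)`-class of a smooth projective fourfold supported on a divisor is algebraic
(`PgOneProductClasses.mem_algebraicClasses_two_of_mem_supportedClasses_one`: Deligne, Hodge III 8.2.8,
with Lefschetz `(1,1)`). [cite: Varesco2023, §2 (p. 8)] [cite: DeligneHodgeIII1974, Cor. 8.2.8]
[cite: VoisinHodgeI2002, Thm. 11.30] -/
theorem mem_algebraicClasses_two_of_cycleInducedSector (μ : OrientationFamily)
    (hS : IsSmoothProjective 2 S)
    (hU : ∀ (f : complexBetti S (2 * 1) →ₗ[ℂ] complexBetti S (2 * 1)),
      (∀ y, IsRationalClass y → IsRationalClass (f y)) →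
      (∀ (i j : ℕ) y, IsOfHodgeType 2 S (2 * 1) i j y → IsOfHodgeType 2 S (2 * 1) i j (f y)) →
      (∀ d ∈ algebraicClasses S 1, f d = 0) →
      (∀ y : complexBetti S (2 * 1), ∀ d ∈ algebraicClasses S 1,
        cupProduct (rfl : 2 * 1 + 2 * 1 = 2 * 2) (f y) d = 0) →
      ∃ g : complexBetti S (2 * 1) →ₗ[ℂ] complexBetti S (2 * 1),
        (∀ d ∈ algebraicClasses S 1, g d ∈ algebraicClasses S 1) ∧
        (∃ γ ∈ algebraicClasses (S ⊗ S) 2, ∀ y : complexBetti S (2 * 1), g y = Corr[μ, hS ; γ, y]) ∧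
        ∀ y : complexBetti S (2 * 1),
          (∀ d ∈ algebraicClasses S 1, cupProduct (rfl : 2 * 1 + 2 * 1 = 2 * 2) y d = 0) → f y = g y)
    {z : complexBetti (S ⊗ S) (2 * 2)} (hzQ : IsRationalClass z)
    (hzT : IsOfHodgeType (2 + 2) (S ⊗ S) (2 * 2) 2 2 z) :
    z ∈ algebraicClasses (S ⊗ S) 2 := by
  have hX : IsSmoothProjective 4 (S ⊗ S) := IsSmoothProjective.tensor_holds hS hS
  obtain ⟨Γ, hΓalg, hΓ⟩ := exists_algebraicClass_of_corrFst_of_cycleInduced μ hS hU hzQ hzT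
  -- `z - Γ` acts trivially on `H²`, hence is divisor-supported
  have hw : ∀ y : complexBetti S (2 * 1), Corr[μ, hS ; z - Γ, y] = 0 := fun y ↦ by
    rw [map_sub, map_sub, hΓ y, sub_self]
  have hN : z - Γ ∈ supportedClasses (S ⊗ S) (2 * 2) 1 :=
    mem_supportedClasses_one_of_corrFst_eq_zero μ hS hw
  have hΓN : Γ ∈ supportedClasses (S ⊗ S) (2 * 2) 1 :=
    supportedClasses_mono (S ⊗ S) (2 * 2) one_le_two hΓalg
  have hz : z ∈ supportedClasses (S ⊗ S) (2 * 2) 1 := by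
    have h := Submodule.add_mem _ hN hΓN
    rwa [sub_add_cancel] at h
  exact PgOneProductClasses.mem_algebraicClasses_two_of_mem_supportedClasses_one hX z hzQ hzT hz

/-! ### The Hodge conjecture for `S × S` on the cycle-induced sector -/

/-- **The Hodge conjecture for `S ⊗ S` on the cycle-induced sector, for EVERY smooth projective
surface `S`**: if every rational Hodge endomorphism of `H²(S(ℂ); ℂ)` killing `N¹H²` with image in
`T = N^⊥` agrees on `T` with an `N`-stable endomorphism induced by an algebraic class on `S × S` (for some
orientation family `μ`) — i.e. `End_Hdg(T(S))` consists of classes of algebraic correspondences — then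
`HodgeConjectureFor 4 (S ⊗ S)`: codimension `2` by `mem_algebraicClasses_two_of_cycleInducedSector`,
codimensions `0, 1, 3, 4` by Lefschetz `(1,1)` and hard Lefschetz
(`hodgeClasses_algebraic_fourfold_of_hodgeTwoTwo`), Hodge models by `nonempty_hodgeModel_holds`.
Generalises `hodgeConjectureFor_square_of_sector` (sector `ℚ + ℚe`). [cite: Varesco2023, §2 (p. 8)]
[cite: VoisinHodgeI2002, Thm. 11.30 and Thm. 6.25] -/
theorem hodgeConjectureFor_square_of_cycleInducedSector (μ : OrientationFamily)
    (hS : IsSmoothProjective 2 S)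
    (hU : ∀ (f : complexBetti S (2 * 1) →ₗ[ℂ] complexBetti S (2 * 1)),
      (∀ y, IsRationalClass y → IsRationalClass (f y)) →
      (∀ (i j : ℕ) y, IsOfHodgeType 2 S (2 * 1) i j y → IsOfHodgeType 2 S (2 * 1) i j (f y)) →
      (∀ d ∈ algebraicClasses S 1, f d = 0) →
      (∀ y : complexBetti S (2 * 1), ∀ d ∈ algebraicClasses S 1,
        cupProduct (rfl : 2 * 1 + 2 * 1 = 2 * 2) (f y) d = 0) →
      ∃ g : complexBetti S (2 * 1) →ₗ[ℂ] complexBetti S (2 * 1),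
        (∀ d ∈ algebraicClasses S 1, g d ∈ algebraicClasses S 1) ∧
        (∃ γ ∈ algebraicClasses (S ⊗ S) 2, ∀ y : complexBetti S (2 * 1), g y = Corr[μ, hS ; γ, y]) ∧
        ∀ y : complexBetti S (2 * 1),
          (∀ d ∈ algebraicClasses S 1, cupProduct (rfl : 2 * 1 + 2 * 1 = 2 * 2) y d = 0) → f y = g y) :
    HodgeConjectureFor 4 (S ⊗ S) := by
  have hX : IsSmoothProjective 4 (S ⊗ S) := IsSmoothProjective.tensor_holds hS hS
  exact ⟨nonempty_hodgeModel_holds hX, fun p c hc hH ↦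
    hodgeClasses_algebraic_fourfold_of_hodgeTwoTwo lefschetzOneOne_rational_holds
      (nonempty_hardLefschetzNFold_holds 4 (S ⊗ S)) hX
      (fun c' hc' hH' ↦ mem_algebraicClasses_two_of_cycleInducedSector μ hS hU hc' hH') p c hc hH⟩

end Summit.HodgeConjecture.HodgeConjecture.Theorems.MarkmanPartnerTransport.CycleInducedSector

end
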